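import Summits.QuantumFields.QCD.Theses.QuarksAsStableAction
import Literature.MathematicalPhysics.QuantumLattice.WilsonDiracAP
import Summits.QuantumFields.QCD.Theorems.QuarksAsStableActionStableActionBridgeProjChainDet
import Summits.QuantumFields.QCD.Theorems.QuarksAsStableActionUnquenchedChessboardBoundStubAxisSwapAux

/-!
# Stub `stub_frequencyDiamagnetism` of line `Sketch` — auxiliary file 1: the 2D frequency operator and its
spin/lattice symmetries
(crux `Summit.QuantumFields.QCD.Theses.QuarksAsStableAction.CriticalLineDiamagnetism`, item stmt-QuantumFields-9734,
static route for odd tori)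

The 2D FREQUENCY OPERATOR of a 2D `U(3)` field `A : ℤ/L → ℤ/L → Fin 4 → U(3)` at mass `m` and antiperiodic
frequency pair `(ω₀, ω₁)` is the `12L² × 12L²` matrix `D = N_ω ⊗ 1 − H_A` on `(ℤ/L × ℤ/L) × colour × spin`, with the
on-site block `N_ω = (m + 4 − cos ω₀ − cos ω₁)·1 + i(sin ω₀ γ₀ + sin ω₁ γ₁)` and the `r = 1` Wilson hops of the links
`A(·,·,2)` (first coordinate) and `A(·,·,3)` (second coordinate), the seam links (coordinate `= −1`) sign-flipped.
Here it is introduced with a GENERAL assignment `g : Fin 4 → M₄(ℂ)` of spin matrices to the four slots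
(`freqOp g A m ω₀ ω₁`; the operator of the stub is `freqOp euclideanGamma`, by `rfl`), and two symmetries are proved:

* spin conjugation: `(1 ⊗ 1 ⊗ S) · freqOp g · (1 ⊗ 1 ⊗ S′) = freqOp (S g S′)` for `S S′ = 1` (`spinLift_conj_freqOp`),
  whence `det freqOp (γ ∘ (0 i) ∘ π) = det freqOp (γ ∘ π)` for the transpositions `(0 i)` realised on the Clifford
  generators by `S_i = γ₅(γ₀ − γ_i)` (`AxisSwap.spinS_mul_euclideanGamma`) (`det_freqOp_swap`);
* the diagonal reflection of the two-torus: exchanging the two coordinates, the two link directions and the spin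
  slots `2 ↔ 3` is a reindexing (`freqOp_submatrix_transpose`).

Consequences: `det D[A] = det D[Aᵀ]` for the reflected field `Aᵀ a b μ = A b a ((2 3) μ)` (`det_freqOp_transpose`:
reindex, then undo `(2 3) = (0 2)(0 3)(0 2)` on the spin slots by three conjugations), and `det D[A]` equals the
determinant of the TIME FORM `tfreqOp = freqOp (γ ∘ (0 2))` (`det_tfreqOp`), in which the first coordinate carries
the Wilson time projections `½(1 ∓ γ₀)` — the input of Lüscher's transfer-matrix reduction (auxiliary files 2, 3),
whose slice data (`projP`, `projM`, `hop3`, `massHop`, `hopCoeff`, `sliceOp`, `sliceBh`, `link2`, `link2'`, `oneStep`)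
are also defined here.  Registered auxiliary theorem: `stub_frequencyDiamagnetismAux1` (the reflection covariance,
stated with the literal `fD` of the stub).
-/

noncomputable section

open scoped BigOperators Matrix ComplexConjugate Kronecker
open Finset
open Literature.MathematicalPhysics.QuantumLattice Literature.MathematicalPhysics.QuantumFieldTheory
  Literature.Probability.LatticeModels

namespace Summit.QuantumFields.QCD.Cruxes.CriticalLineDiamagnetism.ChessboardCellGain

namespace FrequencyDiamagnetism

open Matrix Complex
open Summit.QuantumFields.QCD.Cruxes.StableActionBridge.Sketch
open Summit.QuantumFields.QCD.Theorems.UnquenchedChessboardBoundLine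

/-! ### The frequency operator with a general spin assignment -/

/-- The 2D frequency operator of the 2D field `A` at mass `m` and frequencies `(ω₀, ω₁)`, with the spin matrix `g μ`
in slot `μ` (`μ = 0, 1`: on-site `i sin ω_μ g_μ`; `μ = 2, 3`: Wilson projections `1 ∓ g_μ` of the hops along the
first / second coordinate).  For `g = euclideanGamma` this is LITERALLY the `fD` of the stub statement. -/
def freqOp {L : ℕ} (g : Fin 4 → Matrix (Fin 4) (Fin 4) ℂ)
    (A : ZMod L → ZMod L → Fin 4 → Matrix.unitaryGroup (Fin 3) ℂ) (m ω₀ ω₁ : ℝ) :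
    Matrix ((ZMod L × ZMod L) × Fin 3 × Fin 4) ((ZMod L × ZMod L) × Fin 3 × Fin 4) ℂ :=
  Matrix.of fun (p q : (ZMod L × ZMod L) × Fin 3 × Fin 4) =>
    (if p.1 = q.1 ∧ p.2.1 = q.2.1 then
        (((m + 4 - Real.cos ω₀ - Real.cos ω₁ : ℝ) : ℂ) * (1 : Matrix (Fin 4) (Fin 4) ℂ) p.2.2 q.2.2 +
          Complex.I * (((Real.sin ω₀ : ℝ) : ℂ) * g 0 p.2.2 q.2.2 +
            ((Real.sin ω₁ : ℝ) : ℂ) * g 1 p.2.2 q.2.2))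
      else 0) -
      (1 / 2 : ℂ) *
        ((if q.1 = (p.1.1 + 1, p.1.2) then
            ((1 : Matrix (Fin 4) (Fin 4) ℂ) - g 2) p.2.2 q.2.2 *
              ((if p.1.1 = -1 then (-1 : ℂ) else 1) * (A p.1.1 p.1.2 2 : Matrix (Fin 3) (Fin 3) ℂ) p.2.1 q.2.1)
          else 0) +
         (if p.1 = (q.1.1 + 1, q.1.2) then
            ((1 : Matrix (Fin 4) (Fin 4) ℂ) + g 2) p.2.2 q.2.2 *
              ((if q.1.1 = -1 then (-1 : ℂ) else 1) * (star (A q.1.1 q.1.2 2 : Matrix (Fin 3) (Fin 3) ℂ)) p.2.1 q.2.1)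
          else 0) +
         (if q.1 = (p.1.1, p.1.2 + 1) then
            ((1 : Matrix (Fin 4) (Fin 4) ℂ) - g 3) p.2.2 q.2.2 *
              ((if p.1.2 = -1 then (-1 : ℂ) else 1) * (A p.1.1 p.1.2 3 : Matrix (Fin 3) (Fin 3) ℂ) p.2.1 q.2.1)
          else 0) +
         (if p.1 = (q.1.1, q.1.2 + 1) then
            ((1 : Matrix (Fin 4) (Fin 4) ℂ) + g 3) p.2.2 q.2.2 *
              ((if q.1.2 = -1 then (-1 : ℂ) else 1) * (star (A q.1.1 q.1.2 3 : Matrix (Fin 3) (Fin 3) ℂ)) p.2.1 q.2.1)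
          else 0))

/-- The TIME FORM of the frequency operator: spin slots `γ₂, γ₁, γ₀, γ₃`, i.e. the hops along the first
coordinate carry the Wilson time projections `½(1 ∓ γ₀)`. -/
def tfreqOp {L : ℕ} (A : ZMod L → ZMod L → Fin 4 → Matrix.unitaryGroup (Fin 3) ℂ) (m ω₀ ω₁ : ℝ) :
    Matrix ((ZMod L × ZMod L) × Fin 3 × Fin 4) ((ZMod L × ZMod L) × Fin 3 × Fin 4) ℂ :=
  freqOp (fun μ => euclideanGamma (Equiv.swap (0 : Fin 4) 2 μ)) A m ω₀ ω₁

/-- The `4 × 4` spin block of `freqOp g A m ω₀ ω₁` between the (site, colour) pairs `a` and `b`. -/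
def freqBlock {L : ℕ} (g : Fin 4 → Matrix (Fin 4) (Fin 4) ℂ)
    (A : ZMod L → ZMod L → Fin 4 → Matrix.unitaryGroup (Fin 3) ℂ) (m ω₀ ω₁ : ℝ)
    (a b : (ZMod L × ZMod L) × Fin 3) : Matrix (Fin 4) (Fin 4) ℂ :=
  (if a.1 = b.1 ∧ a.2 = b.2 then
      ((m + 4 - Real.cos ω₀ - Real.cos ω₁ : ℝ) : ℂ) • (1 : Matrix (Fin 4) (Fin 4) ℂ) +
        Complex.I • ((((Real.sin ω₀ : ℝ) : ℂ)) • g 0 + ((Real.sin ω₁ : ℝ) : ℂ) • g 1)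
    else 0) -
    (1 / 2 : ℂ) •
      ((if b.1 = (a.1.1 + 1, a.1.2) then
          ((if a.1.1 = -1 then (-1 : ℂ) else 1) * (A a.1.1 a.1.2 2 : Matrix (Fin 3) (Fin 3) ℂ) a.2 b.2) •
            ((1 : Matrix (Fin 4) (Fin 4) ℂ) - g 2)
        else 0) +
       (if a.1 = (b.1.1 + 1, b.1.2) then
          ((if b.1.1 = -1 then (-1 : ℂ) else 1) * (star (A b.1.1 b.1.2 2 : Matrix (Fin 3) (Fin 3) ℂ)) a.2 b.2) •
            ((1 : Matrix (Fin 4) (Fin 4) ℂ) + g 2)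
        else 0) +
       (if b.1 = (a.1.1, a.1.2 + 1) then
          ((if a.1.2 = -1 then (-1 : ℂ) else 1) * (A a.1.1 a.1.2 3 : Matrix (Fin 3) (Fin 3) ℂ) a.2 b.2) •
            ((1 : Matrix (Fin 4) (Fin 4) ℂ) - g 3)
        else 0) +
       (if a.1 = (b.1.1, b.1.2 + 1) then
          ((if b.1.2 = -1 then (-1 : ℂ) else 1) * (star (A b.1.1 b.1.2 3 : Matrix (Fin 3) (Fin 3) ℂ)) a.2 b.2) •
            ((1 : Matrix (Fin 4) (Fin 4) ℂ) + g 3)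
        else 0))

/-- Entries of `if P then X else 0` for a matrix `X`. -/
theorem ite_zero_apply {m n : Type*} (P : Prop) [Decidable P] (X : Matrix m n ℂ) (i : m) (j : n) :
    (if P then X else 0) i j = if P then X i j else 0 := by
  split_ifs <;> rfl

/-- `freqOp` is assembled from its spin blocks `freqBlock`. -/
theorem freqOp_eq_blocks {L : ℕ} (g : Fin 4 → Matrix (Fin 4) (Fin 4) ℂ)
    (A : ZMod L → ZMod L → Fin 4 → Matrix.unitaryGroup (Fin 3) ℂ) (m ω₀ ω₁ : ℝ) :
    freqOp g A m ω₀ ω₁ = Matrix.of fun p q : (ZMod L × ZMod L) × Fin 3 × Fin 4 =>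
      freqBlock g A m ω₀ ω₁ (p.1, p.2.1) (q.1, q.2.1) p.2.2 q.2.2 := by
  ext p q
  simp only [freqOp, freqBlock, Matrix.of_apply, Matrix.sub_apply, Matrix.add_apply, Matrix.smul_apply,
    ite_zero_apply, smul_eq_mul]
  split_ifs <;> ring

/-! ### The slice data of the time form -/

/-- The lifted Wilson time projection `P⁺ = 1 ⊗ 1 ⊗ ½(1 + γ₀)` on the slice space `ℤ/L × colour × spin`. -/
def projP (L : ℕ) : Matrix (ZMod L × Fin 3 × Fin 4) (ZMod L × Fin 3 × Fin 4) ℂ :=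
  Matrix.of fun a b : ZMod L × Fin 3 × Fin 4 =>
    if a.1 = b.1 ∧ a.2.1 = b.2.1 then ((1 / 2 : ℂ) • (1 + euclideanGamma 0)) a.2.2 b.2.2 else 0

/-- The lifted Wilson time projection `P⁻ = 1 ⊗ 1 ⊗ ½(1 − γ₀)` on the slice space `ℤ/L × colour × spin`. -/
def projM (L : ℕ) : Matrix (ZMod L × Fin 3 × Fin 4) (ZMod L × Fin 3 × Fin 4) ℂ :=
  Matrix.of fun a b : ZMod L × Fin 3 × Fin 4 =>
    if a.1 = b.1 ∧ a.2.1 = b.2.1 then ((1 / 2 : ℂ) • (1 - euclideanGamma 0)) a.2.2 b.2.2 else 0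

/-- The seam-signed gauge hop of row `t` along the second coordinate, on `ℤ/L × colour`. -/
def hop3 {L : ℕ} (A : ZMod L → ZMod L → Fin 4 → Matrix.unitaryGroup (Fin 3) ℂ) (t : ZMod L) :
    Matrix (ZMod L × Fin 3) (ZMod L × Fin 3) ℂ :=
  Matrix.of fun a b : ZMod L × Fin 3 =>
    if b.1 = a.1 + 1 then ((if a.1 = -1 then (-1 : ℂ) else 1) • (A t a.1 3 : Matrix (Fin 3) (Fin 3) ℂ)) a.2 b.2 else 0

/-- The spin-blind slice operator `B_t = M_ω·1 − ½(H_t + H_tᴴ)` of row `t` (Lüscher's `B`). -/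
def massHop {L : ℕ} (A : ZMod L → ZMod L → Fin 4 → Matrix.unitaryGroup (Fin 3) ℂ) (m ω₀ ω₁ : ℝ) (t : ZMod L) :
    Matrix (ZMod L × Fin 3) (ZMod L × Fin 3) ℂ :=
  Matrix.diagonal (fun _ => ((m + 4 - Real.cos ω₀ - Real.cos ω₁ : ℝ) : ℂ)) - (1 / 2 : ℂ) • (hop3 A t + (hop3 A t)ᴴ)

/-- The coefficients of `γ₁, γ₂, γ₃` in the slice operator of row `t`: `i sin ω₁·1`, `i sin ω₀·1`, `½(H_t − H_tᴴ)`. -/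
def hopCoeff {L : ℕ} (A : ZMod L → ZMod L → Fin 4 → Matrix.unitaryGroup (Fin 3) ℂ) (ω₀ ω₁ : ℝ) (t : ZMod L) :
    Fin 3 → Matrix (ZMod L × Fin 3) (ZMod L × Fin 3) ℂ :=
  ![(Complex.I * ((Real.sin ω₁ : ℝ) : ℂ)) • 1, (Complex.I * ((Real.sin ω₀ : ℝ) : ℂ)) • 1,
    (1 / 2 : ℂ) • (hop3 A t - (hop3 A t)ᴴ)]

/-- The slice operator `A_t = B_t ⊗ 1 + Σ_j C_{t,j} ⊗ γ_{j+1}` of row `t` (in Kronecker form). -/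
def sliceOp {L : ℕ} [NeZero L] (A : ZMod L → ZMod L → Fin 4 → Matrix.unitaryGroup (Fin 3) ℂ) (m ω₀ ω₁ : ℝ) (t : ZMod L) :
    Matrix (ZMod L × Fin 3 × Fin 4) (ZMod L × Fin 3 × Fin 4) ℂ :=
  Matrix.reindexAlgEquiv ℂ ℂ (Equiv.prodAssoc (ZMod L) (Fin 3) (Fin 4))
    (massHop A m ω₀ ω₁ t ⊗ₖ (1 : Matrix (Fin 4) (Fin 4) ℂ) +
      ∑ j : Fin 3, hopCoeff A ω₀ ω₁ t j ⊗ₖ euclideanGamma j.succ)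

/-- The spin-diagonal lift `B̂_t = B_t ⊗ 1` of the spin-blind slice operator (in Kronecker form). -/
def sliceBh {L : ℕ} [NeZero L] (A : ZMod L → ZMod L → Fin 4 → Matrix.unitaryGroup (Fin 3) ℂ) (m ω₀ ω₁ : ℝ) (t : ZMod L) :
    Matrix (ZMod L × Fin 3 × Fin 4) (ZMod L × Fin 3 × Fin 4) ℂ :=
  Matrix.reindexAlgEquiv ℂ ℂ (Equiv.prodAssoc (ZMod L) (Fin 3) (Fin 4))
    (massHop A m ω₀ ω₁ t ⊗ₖ (1 : Matrix (Fin 4) (Fin 4) ℂ))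

/-- The forward temporal transporter `W_t = σ_t A(t,·,2) ⊗ 1_spin` of row `t` (`σ_t = −1` on the seam `t = −1`). -/
def link2 {L : ℕ} (A : ZMod L → ZMod L → Fin 4 → Matrix.unitaryGroup (Fin 3) ℂ) (t : ZMod L) :
    Matrix (ZMod L × Fin 3 × Fin 4) (ZMod L × Fin 3 × Fin 4) ℂ :=
  Matrix.of fun a b : ZMod L × Fin 3 × Fin 4 => if a.1 = b.1 ∧ a.2.2 = b.2.2 then
    ((if t = -1 then (-1 : ℂ) else 1) • (A t a.1 2 : Matrix (Fin 3) (Fin 3) ℂ)) a.2.1 b.2.1 else 0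

/-- The backward temporal transporter `W′_t = σ_t A(t,·,2)ᴴ ⊗ 1_spin` of row `t`. -/
def link2' {L : ℕ} (A : ZMod L → ZMod L → Fin 4 → Matrix.unitaryGroup (Fin 3) ℂ) (t : ZMod L) :
    Matrix (ZMod L × Fin 3 × Fin 4) (ZMod L × Fin 3 × Fin 4) ℂ :=
  Matrix.of fun a b : ZMod L × Fin 3 × Fin 4 => if a.1 = b.1 ∧ a.2.2 = b.2.2 then
    ((if t = -1 then (-1 : ℂ) else 1) • (star (A t a.1 2 : Matrix (Fin 3) (Fin 3) ℂ))) a.2.1 b.2.1 else 0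

/-- Lüscher's dressed one-step matrix `M_t = (1 + P⁺C_tP⁻)(B̂_tP⁺ + B̂_t⁻¹P⁻)(1 − P⁻C_tP⁺)`, `C_t = A_t − B̂_t`, of row `t`. -/
def oneStep {L : ℕ} [NeZero L] (A : ZMod L → ZMod L → Fin 4 → Matrix.unitaryGroup (Fin 3) ℂ) (m ω₀ ω₁ : ℝ)
    (t : ZMod L) : Matrix (ZMod L × Fin 3 × Fin 4) (ZMod L × Fin 3 × Fin 4) ℂ :=
  (1 + projP L * (sliceOp A m ω₀ ω₁ t - sliceBh A m ω₀ ω₁ t) * projM L) *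
    (sliceBh A m ω₀ ω₁ t * projP L + (sliceBh A m ω₀ ω₁ t)⁻¹ * projM L) *
    (1 - projM L * (sliceOp A m ω₀ ω₁ t - sliceBh A m ω₀ ω₁ t) * projP L)

/-! ### Spin conjugation -/

section SpinLift

variable {X : Type} [Fintype X] [DecidableEq X] {N : ℕ}

/-- Left multiplication by the spin lift `1 ⊗ 1 ⊗ S`, entrywise. -/
theorem spinLift_mul_apply (S : Matrix (Fin 4) (Fin 4) ℂ) (M : Matrix (X × Fin N × Fin 4) (X × Fin N × Fin 4) ℂ)
    (p q : X × Fin N × Fin 4) :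
    ((Matrix.of fun a b : X × Fin N × Fin 4 => if a.1 = b.1 ∧ a.2.1 = b.2.1 then S a.2.2 b.2.2 else 0) * M) p q =
      ∑ α : Fin 4, S p.2.2 α * M (p.1, p.2.1, α) q := by
  rw [Matrix.mul_apply, Fintype.sum_prod_type, Finset.sum_eq_single_of_mem p.1 (Finset.mem_univ _)
      fun x _ hx => by simp [Ne.symm hx],
    Fintype.sum_prod_type, Finset.sum_eq_single_of_mem p.2.1 (Finset.mem_univ _)
      fun c _ hc => by simp [Ne.symm hc]]
  simp only [Matrix.of_apply, and_self, if_true]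

/-- Right multiplication by the spin lift `1 ⊗ 1 ⊗ S`, entrywise. -/
theorem mul_spinLift_apply (M : Matrix (X × Fin N × Fin 4) (X × Fin N × Fin 4) ℂ) (S : Matrix (Fin 4) (Fin 4) ℂ)
    (p q : X × Fin N × Fin 4) :
    (M * Matrix.of fun a b : X × Fin N × Fin 4 => if a.1 = b.1 ∧ a.2.1 = b.2.1 then S a.2.2 b.2.2 else 0) p q =
      ∑ β : Fin 4, M p (q.1, q.2.1, β) * S β q.2.2 := by
  rw [Matrix.mul_apply, Fintype.sum_prod_type, Finset.sum_eq_single_of_mem q.1 (Finset.mem_univ _)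
      fun x _ hx => by simp [hx],
    Fintype.sum_prod_type, Finset.sum_eq_single_of_mem q.2.1 (Finset.mem_univ _)
      fun c _ hc => by simp [hc]]
  simp only [Matrix.of_apply, and_self, if_true]

/-- **Conjugating a matrix of spin blocks by spin lifts acts on the blocks.** -/
theorem spinLift_conj_blocks (S S' : Matrix (Fin 4) (Fin 4) ℂ) (F : X × Fin N → X × Fin N → Matrix (Fin 4) (Fin 4) ℂ) :
    (Matrix.of fun a b : X × Fin N × Fin 4 => if a.1 = b.1 ∧ a.2.1 = b.2.1 then S a.2.2 b.2.2 else 0) *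
        (Matrix.of fun p q : X × Fin N × Fin 4 => F (p.1, p.2.1) (q.1, q.2.1) p.2.2 q.2.2) *
        (Matrix.of fun a b : X × Fin N × Fin 4 => if a.1 = b.1 ∧ a.2.1 = b.2.1 then S' a.2.2 b.2.2 else 0) =
      Matrix.of fun p q : X × Fin N × Fin 4 => (S * F (p.1, p.2.1) (q.1, q.2.1) * S') p.2.2 q.2.2 := by
  ext p q
  rw [mul_spinLift_apply, Matrix.of_apply, Matrix.mul_apply]
  refine Finset.sum_congr rfl fun β _ => ?_
  rw [spinLift_mul_apply, Matrix.mul_apply]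
  simp only [Matrix.of_apply]

/-- The spin lifts multiply as their spin matrices. -/
theorem spinLift_mul_spinLift (S S' : Matrix (Fin 4) (Fin 4) ℂ) :
    (Matrix.of fun a b : X × Fin N × Fin 4 => if a.1 = b.1 ∧ a.2.1 = b.2.1 then S a.2.2 b.2.2 else 0) *
        (Matrix.of fun a b : X × Fin N × Fin 4 => if a.1 = b.1 ∧ a.2.1 = b.2.1 then S' a.2.2 b.2.2 else 0) =
      Matrix.of fun a b : X × Fin N × Fin 4 => if a.1 = b.1 ∧ a.2.1 = b.2.1 then (S * S') a.2.2 b.2.2 else 0 := by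
  rw [of_spinLift_eq, of_spinLift_eq, of_spinLift_eq, ← Matrix.mul_kronecker_mul, ← Matrix.mul_kronecker_mul,
    Matrix.mul_one, Matrix.mul_one]

omit [Fintype X] in
/-- The spin lift of `1` is `1`. -/
theorem spinLift_one :
    (Matrix.of fun a b : X × Fin N × Fin 4 =>
      if a.1 = b.1 ∧ a.2.1 = b.2.1 then (1 : Matrix (Fin 4) (Fin 4) ℂ) a.2.2 b.2.2 else 0) = 1 := by
  rw [of_spinLift_eq, Matrix.one_kronecker_one, Matrix.one_kronecker_one]

/-- Conjugating a matrix of spin blocks by the lifts of `S`, `S′` with `S S′ = 1` does not change the determinant. -/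
theorem det_spinLift_conj (S S' : Matrix (Fin 4) (Fin 4) ℂ) (hS : S * S' = 1)
    (M : Matrix (X × Fin N × Fin 4) (X × Fin N × Fin 4) ℂ) :
    ((Matrix.of fun a b : X × Fin N × Fin 4 => if a.1 = b.1 ∧ a.2.1 = b.2.1 then S a.2.2 b.2.2 else 0) * M *
        (Matrix.of fun a b : X × Fin N × Fin 4 => if a.1 = b.1 ∧ a.2.1 = b.2.1 then S' a.2.2 b.2.2 else 0)).det =
      M.det := by
  rw [Matrix.det_mul, Matrix.det_mul, mul_comm (Matrix.det (Matrix.of _)) M.det, mul_assoc, ← Matrix.det_mul,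
    spinLift_mul_spinLift, hS, spinLift_one, Matrix.det_one, mul_one]

end SpinLift

/-- **Spin conjugation of the blocks**: `S · freqBlock g · S′ = freqBlock (S g S′)` for `S S′ = 1`. -/
theorem conj_freqBlock {L : ℕ} (S S' : Matrix (Fin 4) (Fin 4) ℂ) (hS : S * S' = 1)
    (g : Fin 4 → Matrix (Fin 4) (Fin 4) ℂ) (A : ZMod L → ZMod L → Fin 4 → Matrix.unitaryGroup (Fin 3) ℂ)
    (m ω₀ ω₁ : ℝ) (a b : (ZMod L × ZMod L) × Fin 3) :
    S * freqBlock g A m ω₀ ω₁ a b * S' = freqBlock (fun μ => S * g μ * S') A m ω₀ ω₁ a b := by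
  simp only [freqBlock, Matrix.mul_sub, Matrix.sub_mul, Matrix.mul_add, Matrix.add_mul, Matrix.mul_smul,
    Matrix.smul_mul, mul_ite, ite_mul, Matrix.mul_zero, Matrix.zero_mul, Matrix.mul_one, hS, Matrix.mul_assoc]

/-- **Spin conjugation of the frequency operator**: `(1 ⊗ 1 ⊗ S) · freqOp g · (1 ⊗ 1 ⊗ S′) = freqOp (S g S′)`. -/
theorem spinLift_conj_freqOp {L : ℕ} [NeZero L] (S S' : Matrix (Fin 4) (Fin 4) ℂ) (hS : S * S' = 1)
    (g : Fin 4 → Matrix (Fin 4) (Fin 4) ℂ) (A : ZMod L → ZMod L → Fin 4 → Matrix.unitaryGroup (Fin 3) ℂ)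
    (m ω₀ ω₁ : ℝ) :
    (Matrix.of fun a b : (ZMod L × ZMod L) × Fin 3 × Fin 4 =>
        if a.1 = b.1 ∧ a.2.1 = b.2.1 then S a.2.2 b.2.2 else 0) * freqOp g A m ω₀ ω₁ *
        (Matrix.of fun a b : (ZMod L × ZMod L) × Fin 3 × Fin 4 =>
          if a.1 = b.1 ∧ a.2.1 = b.2.1 then S' a.2.2 b.2.2 else 0) =
      freqOp (fun μ => S * g μ * S') A m ω₀ ω₁ := by
  rw [freqOp_eq_blocks, freqOp_eq_blocks, spinLift_conj_blocks]
  simp only [conj_freqBlock S S' hS]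

/-- **The determinant is blind to a transposition `(0 i)` of the spin slots**: for `i ≠ 0` and any slot map `π`,
`det freqOp (γ ∘ (0 i) ∘ π) = det freqOp (γ ∘ π)` (conjugation by the lift of `S_i = γ₅(γ₀ − γ_i)`). -/
theorem det_freqOp_swap {L : ℕ} [NeZero L] {i : Fin 4} (hi : i ≠ 0) (π : Fin 4 → Fin 4)
    (A : ZMod L → ZMod L → Fin 4 → Matrix.unitaryGroup (Fin 3) ℂ) (m ω₀ ω₁ : ℝ) :
    (freqOp (fun μ => euclideanGamma (Equiv.swap (0 : Fin 4) i (π μ))) A m ω₀ ω₁).det =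
      (freqOp (fun μ => euclideanGamma (π μ)) A m ω₀ ω₁).det := by
  have hSS' := AxisSwap.spinS_mul_spinS' hi
  have hconj : (fun μ => euclideanGamma (Equiv.swap (0 : Fin 4) i (π μ))) = fun μ =>
      gammaFive * (euclideanGamma 0 - euclideanGamma i) * euclideanGamma (π μ) *
        ((2 : ℂ)⁻¹ • ((euclideanGamma 0 - euclideanGamma i) * gammaFive)) := by
    funext μ
    rw [AxisSwap.spinS_mul_euclideanGamma hi, Matrix.mul_assoc, hSS', Matrix.mul_one]
  rw [hconj, ← spinLift_conj_freqOp _ _ hSS', det_spinLift_conj _ _ hSS']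

/-! ### The diagonal reflection of the two-torus -/

/-- **Exchanging the two coordinates, the two link directions and the spin slots `2 ↔ 3` is a reindexing of the
frequency operator.** -/
theorem freqOp_submatrix_transpose {L : ℕ} (g : Fin 4 → Matrix (Fin 4) (Fin 4) ℂ)
    (A : ZMod L → ZMod L → Fin 4 → Matrix.unitaryGroup (Fin 3) ℂ) (m ω₀ ω₁ : ℝ) :
    (freqOp g A m ω₀ ω₁).submatrix
        (fun p : (ZMod L × ZMod L) × Fin 3 × Fin 4 => ((p.1.2, p.1.1), p.2))
        (fun p : (ZMod L × ZMod L) × Fin 3 × Fin 4 => ((p.1.2, p.1.1), p.2)) =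
      freqOp (fun μ => g (Equiv.swap (2 : Fin 4) 3 μ)) (fun a b μ => A b a (Equiv.swap (2 : Fin 4) 3 μ))
        m ω₀ ω₁ := by
  have h0 : Equiv.swap (2 : Fin 4) 3 0 = 0 := by decide
  have h1 : Equiv.swap (2 : Fin 4) 3 1 = 1 := by decide
  have h2 : Equiv.swap (2 : Fin 4) 3 2 = 3 := by decide
  have h3 : Equiv.swap (2 : Fin 4) 3 3 = 2 := by decide
  ext ⟨⟨a, b⟩, c, α⟩ ⟨⟨d, e⟩, f, β⟩
  simp only [freqOp, Matrix.submatrix_apply, Matrix.of_apply, h0, h1, h2, h3, Prod.mk.injEq]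
  simp only [and_comm, and_assoc]
  ring

/-- **The frequency determinant is invariant under the diagonal reflection**: `det D[A] = det D[Aᵀ]` with
`Aᵀ a b μ = A b a ((2 3) μ)`. -/
theorem det_freqOp_transpose {L : ℕ} [NeZero L] (A : ZMod L → ZMod L → Fin 4 → Matrix.unitaryGroup (Fin 3) ℂ)
    (m ω₀ ω₁ : ℝ) :
    (freqOp euclideanGamma A m ω₀ ω₁).det =
      (freqOp euclideanGamma (fun a b μ => A b a (Equiv.swap (2 : Fin 4) 3 μ)) m ω₀ ω₁).det := by
  -- reindex
  have h1 : (freqOp euclideanGamma A m ω₀ ω₁).det =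
      (freqOp (fun μ => euclideanGamma (Equiv.swap (2 : Fin 4) 3 μ))
        (fun a b μ => A b a (Equiv.swap (2 : Fin 4) 3 μ)) m ω₀ ω₁).det := by
    rw [← freqOp_submatrix_transpose]
    exact (Matrix.det_submatrix_equiv_self
      ((Equiv.prodComm (ZMod L) (ZMod L)).prodCongr (Equiv.refl (Fin 3 × Fin 4))) _).symm
  -- undo `(2 3) = (0 2)(0 3)(0 2)` on the spin slots by three conjugations
  have h2 : (euclideanGamma : Fin 4 → Matrix (Fin 4) (Fin 4) ℂ) = fun μ => euclideanGamma
      (Equiv.swap (0 : Fin 4) 2 (Equiv.swap (0 : Fin 4) 3 (Equiv.swap (0 : Fin 4) 2 (Equiv.swap (2 : Fin 4) 3 μ)))) := by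
    funext μ
    congr 1
    revert μ
    decide
  have h20 : (2 : Fin 4) ≠ 0 := by decide
  have h30 : (3 : Fin 4) ≠ 0 := by decide
  rw [h1]
  conv_rhs => rw [h2]
  rw [det_freqOp_swap h20 (fun μ => Equiv.swap (0 : Fin 4) 3 (Equiv.swap (0 : Fin 4) 2 (Equiv.swap (2 : Fin 4) 3 μ))),
    det_freqOp_swap h30 (fun μ => Equiv.swap (0 : Fin 4) 2 (Equiv.swap (2 : Fin 4) 3 μ)),
    det_freqOp_swap h20 (fun μ => Equiv.swap (2 : Fin 4) 3 μ)]

/-- **The frequency determinant equals the determinant of the time form**: `det D[A] = det tfreqOp A`. -/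
theorem det_tfreqOp {L : ℕ} [NeZero L] (A : ZMod L → ZMod L → Fin 4 → Matrix.unitaryGroup (Fin 3) ℂ)
    (m ω₀ ω₁ : ℝ) :
    (tfreqOp A m ω₀ ω₁).det = (freqOp euclideanGamma A m ω₀ ω₁).det :=
  det_freqOp_swap (by decide) id A m ω₀ ω₁

end FrequencyDiamagnetism

/-! ### Registered auxiliary theorem -/

/-- **Aux stub `stub_frequencyDiamagnetismAux1`** (reflection covariance of the 2D frequency determinant): for every
2D `U(3)` field `A`, mass `m` and real frequency pair, `det D[A] = det D[Aᵀ]` where the reflected field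
`Aᵀ a b μ = A b a ((2 3) μ)` exchanges the two coordinates and the two link directions (`D = fD` literally the
frequency operator of the stub `stub_frequencyDiamagnetism`). -/
theorem stub_frequencyDiamagnetismAux1 : ∀ (L : ℕ) [NeZero L] (A : ZMod L → ZMod L → Fin 4 → Matrix.unitaryGroup (Fin 3) ℂ) (m ω₀ ω₁ : ℝ), let fD := fun (A : ZMod L → ZMod L → Fin 4 → Matrix.unitaryGroup (Fin 3) ℂ) (m ω₀ ω₁ : ℝ) => Matrix.of fun (p q : (ZMod L × ZMod L) × Fin 3 × Fin 4) => (if p.1 = q.1 ∧ p.2.1 = q.2.1 then (((m + 4 - Real.cos ω₀ - Real.cos ω₁ : ℝ) : ℂ) * (1 : Matrix (Fin 4) (Fin 4) ℂ) p.2.2 q.2.2 + Complex.I * (((Real.sin ω₀ : ℝ) : ℂ) * euclideanGamma 0 p.2.2 q.2.2 + ((Real.sin ω₁ : ℝ) : ℂ) * euclideanGamma 1 p.2.2 q.2.2)) else 0) - (1 / 2 : ℂ) * ((if q.1 = (p.1.1 + 1, p.1.2) then ((1 : Matrix (Fin 4) (Fin 4) ℂ) - euclideanGamma 2) p.2.2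 q.2.2 * ((if p.1.1 = -1 then (-1 : ℂ) else 1) * (A p.1.1 p.1.2 2 : Matrix (Fin 3) (Fin 3) ℂ) p.2.1 q.2.1) else 0) + (if p.1 = (q.1.1 + 1, q.1.2) then ((1 : Matrix (Fin 4) (Fin 4) ℂ) + euclideanGamma 2) p.2.2 q.2.2 * ((if q.1.1 = -1 then (-1 : ℂ) else 1) * (star (A q.1.1 q.1.2 2 : Matrix (Fin 3) (Fin 3) ℂ)) p.2.1 q.2.1) else 0) + (if q.1 = (p.1.1, p.1.2 + 1) then ((1 : Matrix (Fin 4) (Fin 4) ℂ) - euclideanGamma 3) p.2.2 q.2.2 * ((if p.1.2 = -1 then (-1 : ℂ) else 1) * (A p.1.1 p.1.2 3 : Matrix (Fin 3) (Fin 3) ℂ) p.2.1 q.2.1) else 0) + (if p.1 = (q.1.1, q.1.2 + 1) then ((1 : Matrix (Fin 4) (Fin 4) ℂ) + euclideanGamma 3) p.2.2 q.2.2 * ((if q.1.2 = -1 then (-1 : ℂ) else 1) * (star (A q.1.1 q.1.2 3 : Matrix (Fin 3) (Fin 3) ℂ)) p.2.1 q.2.1) else 0)); (fD A m ω₀ ω₁).det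 = (fD (fun a b μ => A b a (Equiv.swap (2 : Fin 4) 3 μ)) m ω₀ ω₁).det := by
  intro L _ A m ω₀ ω₁ fD
  exact FrequencyDiamagnetism.det_freqOp_transpose A m ω₀ ω₁

end Summit.QuantumFields.QCD.Cruxes.CriticalLineDiamagnetism.ChessboardCellGain

end
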